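import Summits.KontsevichZagierPeriods.KontsevichZagierPeriods.Theorems.LinRedNormalFormArrangementNormalFormStubRebaseSimplePosJanus
import Summits.KontsevichZagierPeriods.KontsevichZagierPeriods.Theorems.LinRedNormalFormArrangementNormalFormStubRebaseSimplePosProduct

/-!
# Stub `stub_rebaseSimpleZero`, part `rebaseSimpleZero_product` (crux `ArrangementNormalForm`, line `janus-bands`, v6.2) — `Tools`

Dictionary for the rebase over a ONE-dimensional base `y` with `k` PRODUCT fibres `tᵢ` (every
fibre bound an affine function of `y`), on the LITERAL class text `GG 0 σ k` of the skeleton: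
affine atoms `c : (Fin (0+1) → ℚ) × ℚ` with value `ev c y`, the coordinates `yv`/`tv`, the base
cell `cell M` and the product domain `pDom M U V = {y ∈ cell M, Uᵢ(y) < tᵢ < Vᵢ(y)}` (a
`SeparatePos.gDom`), product representations `IsProd` (literal domain, literal integrand
`RebasePos.glit`, bounded base cell), the target predicate `Good k` (congruent modulo
`KZ.relations` to the subgroup generated by the literal class `GG 0 2 k`), the format predicate
`InFmt` (constant letter, bounds constant or `y`), the continuation hypothesis `HP` of the
fibre-by-fibre induction, and the data of the moves on ONE fibre `i`: the vectors `pullMu/pullAl/pullDe` of the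
single-fibre pull-back, the fibrewise affine map `fibAff` and the blow-up map `fibBlow` with their
derivatives. Registered: `rebaseSimpleZeroProduct_mem_pDom`.

References: M. Kontsevich, D. Zagier, *Periods* (2001), §1.2.
-/

noncomputable section

open Set MeasureTheory MvPolynomial
open Literature.NumberTheory.Transcendental Literature.ModelTheory.ExponentialFields

namespace Summit.KontsevichZagierPeriods.ArrangementNormalForm.JanusBands

namespace RebaseZero

open SeparatePos RebasePos

variable {k : ℕ}

/-- Affine atoms of the literal text over a one-dimensional base. [folklore] -/
abbrev Cf : Type := (Fin (0 + 1) → ℚ) × ℚ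

/-- `Fin (0 + 1)` has one element. [folklore] -/
theorem eq_last (j : Fin (0 + 1)) : j = Fin.last 0 :=
  Fin.ext (by have := j.isLt; simp only [Fin.val_last]; omega)

/-- Value `α y + β` of an atom. [folklore] -/
def ev (c : Cf) (y : ℝ) : ℝ := (c.1 (Fin.last 0) : ℝ) * y + (c.2 : ℝ)

/-- The atom with slope `α` and intercept `β`. [folklore] -/
def mk (α β : ℚ) : Cf := (fun _ => α, β)

/-- Value of `mk`. [folklore] -/
@[simp] theorem ev_mk (α β : ℚ) (y : ℝ) : ev (mk α β) y = α * y + β := rfl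

/-- Slope of `mk`. [folklore] -/
@[simp] theorem mk_fst (α β : ℚ) (j : Fin (0 + 1)) : (mk α β).1 j = α := rfl

/-- Intercept of `mk`. [folklore] -/
@[simp] theorem mk_snd (α β : ℚ) : (mk α β).2 = β := rfl

/-- Every atom is an `mk`. [folklore] -/
theorem mk_eta (c : Cf) : mk (c.1 (Fin.last 0)) c.2 = c := by
  refine Prod.ext (funext fun j => ?_) rfl
  rw [eq_last j]; rfl

/-- The atom `y` in the skeleton's spelling. [folklore] -/
theorem mk_one_zero : mk 1 0 = ((Pi.single (Fin.last 0) 1 : Fin (0 + 1) → ℚ), (0 : ℚ)) := by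
  refine Prod.ext (funext fun j => ?_) rfl
  rw [eq_last j]; simp [mk]

/-- `ev` is additive. [folklore] -/
@[simp] theorem ev_add (c d : Cf) (y : ℝ) : ev (c + d) y = ev c y + ev d y := by
  simp only [ev, Prod.fst_add, Prod.snd_add, Pi.add_apply, Rat.cast_add]; ring

/-- `ev` of a difference. [folklore] -/
@[simp] theorem ev_sub (c d : Cf) (y : ℝ) : ev (c - d) y = ev c y - ev d y := by
  simp only [ev, Prod.fst_sub, Prod.snd_sub, Pi.sub_apply, Rat.cast_sub]; ring

/-- `ev` of a negative. [folklore] -/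
@[simp] theorem ev_neg (c : Cf) (y : ℝ) : ev (-c) y = -ev c y := by
  simp only [ev, Prod.fst_neg, Prod.snd_neg, Pi.neg_apply, Rat.cast_neg]; ring

/-- Slope of a sum. [folklore] -/
theorem add_fst (c d : Cf) : (c + d).1 (Fin.last 0) = c.1 (Fin.last 0) + d.1 (Fin.last 0) := rfl

/-- Slope of a difference. [folklore] -/
theorem sub_fst (c d : Cf) : (c - d).1 (Fin.last 0) = c.1 (Fin.last 0) - d.1 (Fin.last 0) := rfl

/-- Slope of a negative. [folklore] -/
theorem neg_fst (c : Cf) : (-c).1 (Fin.last 0) = -c.1 (Fin.last 0) := rfl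

/-! ### Coordinates -/

/-- Index of the base coordinate `y`. [folklore] -/
def yIdx (k : ℕ) : Fin (0 + 1 + k) := Fin.castAdd k (Fin.last 0)

/-- Index of the fibre coordinate `tᵢ`. [folklore] -/
def tIdx (i : Fin k) : Fin (0 + 1 + k) := Fin.natAdd (0 + 1) i

/-- The base coordinate. [folklore] -/
def yv (z : Fin (0 + 1 + k) → ℝ) : ℝ := z (yIdx k)

/-- The fibre coordinates. [folklore] -/
def tv (z : Fin (0 + 1 + k) → ℝ) (i : Fin k) : ℝ := z (tIdx i)

/-- `y` is not a fibre coordinate. [folklore] -/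
theorem yIdx_ne_tIdx (i : Fin k) : yIdx k ≠ tIdx i := IntegrateOutLow.castAdd_ne_natAdd _ _

/-- Distinct fibres have distinct coordinates. [folklore] -/
theorem tIdx_injective : Function.Injective (tIdx (k := k)) := fun i j h => by
  have := congrArg Fin.val h
  simp only [tIdx, Fin.val_natAdd] at this
  exact Fin.ext (by omega)

/-- Every coordinate is `y` or a fibre. [folklore] -/
theorem idx_cases (l : Fin (0 + 1 + k)) : l = yIdx k ∨ ∃ i, l = tIdx i := by
  refine Fin.addCases (fun j => ?_) (fun i => Or.inr ⟨i, rfl⟩) l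
  rw [eq_last j]; exact Or.inl rfl

/-- `yv` after updating a fibre coordinate. [folklore] -/
@[simp] theorem yv_update (z : Fin (0 + 1 + k) → ℝ) (i : Fin k) (x : ℝ) :
    yv (Function.update z (tIdx i) x) = yv z := by
  simp [yv, Function.update_of_ne (yIdx_ne_tIdx i)]

/-- `tv` after updating the same fibre coordinate. [folklore] -/
@[simp] theorem tv_update_self (z : Fin (0 + 1 + k) → ℝ) (i : Fin k) (x : ℝ) :
    tv (Function.update z (tIdx i) x) i = x := by
  simp [tv]

/-- `tv` after updating another fibre coordinate. [folklore] -/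
theorem tv_update_of_ne (z : Fin (0 + 1 + k) → ℝ) {i j : Fin k} (h : j ≠ i) (x : ℝ) :
    tv (Function.update z (tIdx i) x) j = tv z j := by
  simp [tv, Function.update_of_ne (tIdx_injective.ne h)]

/-- Full-base affine forms of the literal text are atoms in `y`. [folklore] -/
theorem affF_eq (c : Cf) (z : Fin (0 + 1 + k) → ℝ) : affF 0 k c z = ev c (yv z) := by
  simp only [affF, ev, yv, yIdx, Fin.sum_univ_castSucc, Finset.univ_eq_empty, Finset.sum_empty,
    zero_add]

/-- The literal affine sum is an atom in `y`. [folklore] -/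
theorem sum_eq (c : Cf) (z : Fin (0 + 1 + k) → ℝ) :
    (∑ i', (c.1 i' : ℝ) * z (Fin.castAdd k i') + (c.2 : ℝ)) = ev c (yv z) := by
  rw [← affF_eq]; rfl

/-- Affine players. [folklore] -/
theorem pv_inr (c : Cf) (z : Fin (0 + 1 + k) → ℝ) : pv (K := k) (Sum.inr c) z = ev c (yv z) := by
  rw [← affF_eq]; rfl

/-- Fibre players. [folklore] -/
theorem pv_inl (j : Fin k) (z : Fin (0 + 1 + k) → ℝ) : pv (B := 0) (Sum.inl j : Fin k ⊕ Cf) z = tv z j :=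
  rfl

/-! ### Product domains -/

/-- The base cell `{y | ∀ j, 0 < ev (M j) y}`. [folklore] -/
def cell {m' : ℕ} (M : Fin m' → Cf) : Set ℝ := {y | ∀ j, 0 < ev (M j) y}

/-- Adding a row to the base cell. [folklore] -/
theorem mem_cell_snoc {m' : ℕ} (M : Fin m' → Cf) (q : Cf) (y : ℝ) :
    y ∈ cell (Fin.snoc M q : Fin (m' + 1) → Cf) ↔ y ∈ cell M ∧ 0 < ev q y := by
  simp only [cell, mem_setOf_eq, Fin.forall_fin_succ', Fin.snoc_castSucc, Fin.snoc_last]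

/-- The product domain `{y ∈ cell M, Uᵢ(y) < tᵢ < Vᵢ(y)}` as a literal `gDom`. [folklore] -/
def pDom {m' : ℕ} (M : Fin m' → Cf) (U V : Fin k → Cf) : Set (Fin (0 + 1 + k) → ℝ) :=
  gDom 0 k m' M (fun i => Sum.inr (U i)) (fun i => Sum.inr (V i))

/-- Membership in a product domain. [folklore] -/
theorem mem_pDom {m' : ℕ} (M : Fin m' → Cf) (U V : Fin k → Cf) (z : Fin (0 + 1 + k) → ℝ) :
    z ∈ pDom M U V ↔ yv z ∈ cell M ∧ ∀ i, ev (U i) (yv z) < tv z i ∧ tv z i < ev (V i) (yv z) := by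
  simp only [pDom, gDom, cell, mem_setOf_eq, Sum.elim_inr, sum_eq]
  rfl

/-- Updating one affine bound. [folklore] -/
theorem update_inr (U : Fin k → Cf) (i : Fin k) (c : Cf) :
    Function.update (fun j => (Sum.inr (U j) : Fin k ⊕ Cf)) i (Sum.inr c) =
      fun j => Sum.inr (Function.update U i c j) := by
  funext j
  by_cases h : j = i
  · subst h; simp
  · simp [Function.update_of_ne h]

/-- Product domains are semialgebraic. [folklore] -/
theorem isSemialgebraic_pDom {m' : ℕ} (M : Fin m' → Cf) (U V : Fin k → Cf) :
    IsSemialgebraic ℚ (pDom M U V) :=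
  isSemialgebraic_gDom _ _ _ _

/-- Product domains are measurable. [folklore] -/
theorem measurableSet_pDom {m' : ℕ} (M : Fin m' → Cf) (U V : Fin k → Cf) :
    MeasurableSet (pDom M U V) :=
  IsSemialgebraic.measurableSet_holds (isSemialgebraic_pDom M U V)

/-! ### Product representations and the target -/

/-- The base-factor data `L, e, ℓ₁, ℓ₂, n₁, n₂` of the literal text (never changed by the moves). -/
structure BData where
  /-- number of `x'`-denominators -/
  m : ℕ
  /-- the `x'`-denominators (constants) -/
  L : Fin m → (Fin 0 → ℚ) × ℚ
  /-- their exponents -/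
  e : Fin m → ℕ
  /-- first base centre -/
  ℓ₁ : (Fin 0 → ℚ) × ℚ
  /-- second base centre -/
  ℓ₂ : (Fin 0 → ℚ) × ℚ
  /-- numerator exponent -/
  n₁ : ℕ
  /-- denominator exponent -/
  n₂ : ℕ

/-- The literal integrand with base-factor data `T`, numerator `p` and letters `a`. [folklore] -/
def glitB (T : BData) (p : MvPolynomial (Fin 0) ℚ) (a : Fin k → Option Cf) :
    (Fin (0 + 1 + k) → ℝ) → ℝ :=
  glit 0 k p T.L T.e T.ℓ₁ T.ℓ₂ T.n₁ T.n₂ a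

/-- `s` is the PRODUCT representation with rows `M`, bounds `Uᵢ < tᵢ < Vᵢ`, base-factor data `T`,
numerator `p` and letters `a`, over a bounded base cell. [folklore] -/
structure IsProd (s : KZ.IntegralRep (0 + 1 + k)) {m' : ℕ} (M : Fin m' → Cf) (U V : Fin k → Cf)
    (T : BData) (p : MvPolynomial (Fin 0) ℚ) (a : Fin k → Option Cf) : Prop where
  /-- the domain is the product domain -/
  dom : s.domain = pDom M U V
  /-- the integrand is the literal one -/
  int : EqOn s.integrand (glitB T p a) s.domain
  /-- admissible exponents -/
  adm : T.n₁ = 0 ∨ T.n₂ = 0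
  /-- the base cell is bounded -/
  cbd : ∃ R : ℝ, ∀ y ∈ cell M, |y| ≤ R

/-- `GOOD` formal combinations: congruent modulo `KZ.relations` to the subgroup generated by the
literal class `GG 0 2 k`. [folklore] -/
def Good (k : ℕ) (x : KZ.FormalRep) : Prop :=
  ∃ c ∈ AddSubgroup.closure (GGset 0 2 k), x - c ∈ KZ.relations

/-- Fibre data IN FORMAT: constant letter, bounds constant or literally `y`. [folklore] -/
def InFmt (a : Option Cf) (U V : Cf) : Prop :=
  (∀ c, a = some c → c.1 (Fin.last 0) = 0) ∧
    (U.1 (Fin.last 0) = 0 ∨ U = (Pi.single (Fin.last 0) 1, 0)) ∧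
    (V.1 (Fin.last 0) = 0 ∨ V = (Pi.single (Fin.last 0) 1, 0))

/-- The CONTINUATION hypothesis of the fibre-by-fibre induction: every product representation
(same `T`) whose fibre `i` is in format and whose other fibres carry the data `(a, U, V)` is
good. [folklore] -/
def HP (T : BData) (i : Fin k) (U V : Fin k → Cf) (a : Fin k → Option Cf) : Prop :=
  ∀ (m' : ℕ) (s : KZ.IntegralRep (0 + 1 + k)) (M : Fin m' → Cf) (U' V' : Fin k → Cf)
    (p : MvPolynomial (Fin 0) ℚ) (a' : Fin k → Option Cf), IsProd s M U' V' T p a' →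
    InFmt (a' i) (U' i) (V' i) → (∀ j, j ≠ i → a' j = a j ∧ U' j = U j ∧ V' j = V j) →
    Good k (KZ.of s)

/-! ### The data of the moves -/

/-- Scalings of the single-fibre pull-back: `μ` at `i`, `1` elsewhere. [folklore] -/
def pullMu (i : Fin k) (μ : ℚ) : Fin k → ℚ := Function.update (fun _ => 1) i μ

/-- Shear slopes of the single-fibre pull-back: `α` at `i`, `0` elsewhere. [folklore] -/
def pullAl (i : Fin k) (α : ℚ) : Fin k → ℚ := Function.update (fun _ => 0) i α

/-- Shifts of the single-fibre pull-back: `δ` at `i`, `0` elsewhere. [folklore] -/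
def pullDe (i : Fin k) (δ : (Fin 0 → ℚ) × ℚ) : Fin k → (Fin 0 → ℚ) × ℚ := Function.update (fun _ => 0) i δ

/-- The fibrewise affine map `tᵢ ↦ β y + l tᵢ + ν` (other coordinates fixed). [folklore] -/
def fibAff (i : Fin k) (β l ν : ℝ) (z : Fin (0 + 1 + k) → ℝ) : Fin (0 + 1 + k) → ℝ :=
  z + (β * yv z + (l - 1) * tv z i + ν) • (Pi.single (tIdx i) (1 : ℝ) : Fin (0 + 1 + k) → ℝ)

/-- The linear part of `fibAff`. [folklore] -/
def fibAffL (i : Fin k) (β l : ℝ) : (Fin (0 + 1 + k) → ℝ) →L[ℝ] (Fin (0 + 1 + k) → ℝ) :=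
  ContinuousLinearMap.id ℝ _ + ContinuousLinearMap.smulRight
    (β • (ContinuousLinearMap.proj (R := ℝ) (φ := fun _ : Fin (0 + 1 + k) => ℝ) (yIdx k)) +
      (l - 1) • (ContinuousLinearMap.proj (R := ℝ) (φ := fun _ : Fin (0 + 1 + k) => ℝ) (tIdx i)))
    (Pi.single (tIdx i) (1 : ℝ) : Fin (0 + 1 + k) → ℝ)

/-- The blow-up map `sᵢ ↦ γ y + δ + sᵢ (y − p)` (other coordinates fixed). [folklore] -/
def fibBlow (i : Fin k) (γ δ p : ℝ) (z : Fin (0 + 1 + k) → ℝ) : Fin (0 + 1 + k) → ℝ :=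
  z + (γ * yv z + δ + tv z i * (yv z - p) - tv z i) • (Pi.single (tIdx i) (1 : ℝ) : Fin (0 + 1 + k) → ℝ)

/-- The derivative of the blow-up map at `z`. [folklore] -/
def fibBlowL (i : Fin k) (γ p : ℝ) (z : Fin (0 + 1 + k) → ℝ) :
    (Fin (0 + 1 + k) → ℝ) →L[ℝ] (Fin (0 + 1 + k) → ℝ) :=
  ContinuousLinearMap.id ℝ _ + ContinuousLinearMap.smulRight
    (γ • (ContinuousLinearMap.proj (R := ℝ) (φ := fun _ : Fin (0 + 1 + k) => ℝ) (yIdx k)) +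
      (z (tIdx i) • (ContinuousLinearMap.proj (R := ℝ) (φ := fun _ : Fin (0 + 1 + k) => ℝ) (yIdx k)) +
        (z (yIdx k) - p) • (ContinuousLinearMap.proj (R := ℝ) (φ := fun _ : Fin (0 + 1 + k) => ℝ) (tIdx i))) -
      (ContinuousLinearMap.proj (R := ℝ) (φ := fun _ : Fin (0 + 1 + k) => ℝ) (tIdx i)))
    (Pi.single (tIdx i) (1 : ℝ) : Fin (0 + 1 + k) → ℝ)

end RebaseZero

/-- Registered support goal of this file: membership in a product domain of the literal text over
a one-dimensional base. -/
theorem rebaseSimpleZeroProduct_mem_pDom (k m' : ℕ) (M : Fin m' → (Fin (0 + 1) → ℚ) × ℚ) (U V : Fin k → (Fin (0 + 1) → ℚ) × ℚ) (z : Fin (0 + 1 + k) → ℝ) : z ∈ RebaseZero.pDom M U V ↔ RebaseZero.yv z ∈ RebaseZero.cell M ∧ ∀ i, RebaseZero.ev (U i) (RebaseZero.yv z) < RebaseZero.tv z i ∧ RebaseZero.tv z i < RebaseZero.ev (V i) (RebaseZero.yv z) :=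
  RebaseZero.mem_pDom M U V z

end Summit.KontsevichZagierPeriods.ArrangementNormalForm.JanusBands
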